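import Literature.MathematicalPhysics.QuantumLattice.SchwartzOrderedWedgeDensity
import Literature.MathematicalPhysics.AQFT.OSAxiomsSchwinger
import Summits.QuantumFields.YangMills.Theorems.LangevinControlUVOSLegsAtWeakCouplingCStubLocalityFlatApprox
import HarnessLib

/-!
# Off-diagonal real tensor products are total in `⁰𝒮((ℝ⁴)ⁿ)`

Helper file for stub `stub_offDiagonalTensorDensity` of crux `QuarksAsStableAction.StableActionBridge`
(item stmt-QuantumFields-9737, line `Sketch`, reshape r3d): pure Schwartz-space analysis, no QCD.

Every `F ∈ ⁰𝒮((ℝ⁴)ⁿ)` (a Schwartz `n`-point test function vanishing with all derivatives on the coincidence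
locus, `IsOffDiagonal`) lies in the closure, in `𝓢(((ℝ⁴)ⁿ), ℂ)`, of the `ℂ`-span of those tensor products
`f₁ ⊗ ⋯ ⊗ fₙ` of complexified REAL one-point test functions (`tensorProducts n`) that are themselves
off-diagonal.  Route (the `⁰𝒮` form of `𝒮(ℝ^{4n}) = ⊗̂ⁿ 𝒮(ℝ⁴)`, OS 1973 §2; the time-ordered analogue is the
tree's `IsTimeOrdered.mem_closure_span_slabOrderedProducts`, whose structure is adapted here):

1. `F` is the Schwartz limit of compactly supported `u_m` supported at pairwise distances `≥ δ_m > 0`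
   (`exists_separated_tendsto_of_isOffDiagonal`, `Separated n δ`); the closure being closed it suffices to
   treat one such `u` (`offDiag_mem_closure_of_separated`).
2. The lattice partition of unity `η_β` of `SchwartzPartition` in the mesh coordinates `meshCoord n 4 h`
   at mesh `h = δ / 24` converges on Schwartz space (`tendsto_latticeWindow_smul`): `∑_{β ∈ cube R} η_β u → u`;
   so it suffices that every piece `η_β u` lies in the closed span.
3. One piece (`offDiag_piece_mem_closure`): `η_β u` is supported in the closed box
   `∏ [(β_{ic} - 1) h, (β_{ic} + 1) h]`; unless it vanishes, the box contains a point `v` of `supp u`, whose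
   particle coordinates are pairwise `≥ δ > 12 h` apart, whence the OUTER per-particle blocks
   `∏_c ((β_{ic} - 2) h, (β_{ic} + 2) h)` are pairwise disjoint.  The box engine
   `mem_closure_span_boxTensors` puts the piece in the closed span of real tensors with factors supported in
   these blocks, and such tensors are off-diagonal (`offDiag_boxTensors_subset`: at a coincident point
   `x_i = x_j`, `i ≠ j`, of the support the common value would lie in two disjoint blocks).

Refs: K. Osterwalder, R. Schrader, Comm. Math. Phys. 31 (1973) 83–112, §2 (the spaces `⁰𝒮`, `⊗̂ⁿ 𝒮`);
the Fourier-series/partition-of-unity proof is textbook folklore.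
-/

noncomputable section

open scoped SchwartzMap
open Filter Topology Set
open Literature.MathematicalPhysics.AQFT Literature.MathematicalPhysics.QuantumLattice
open Summit.QuantumFields.YangMills.Cruxes.OSLegsAtWeakCouplingC.Sketch (Separated
  exists_separated_tendsto_of_isOffDiagonal)

local notation "E4" => EuclideanSpace ℝ (Fin 4)

namespace Summit.QuantumFields.QCD.Cruxes.StableActionBridge.Sketch

/-- **Box tensors over pairwise disjoint blocks are off-diagonal real tensor products.**  If the outer
per-particle blocks `{x | ∀ c, Λ(x)_c ∈ (l_{ic}, u_{ic})}` of `B : BoxData n m` are pairwise disjoint, every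
element of `B.boxTensors Λ` (a tensor `g₁ ⊗ ⋯ ⊗ gₙ` of real test functions with `supp gᵢ ⊆ block i`) belongs
to `tensorProducts n` and is `IsOffDiagonal`: a point `x` of its support has `xᵢ ∈ supp gᵢ ⊆ block i` for all
`i`, so `xᵢ = xⱼ` with `i ≠ j` is impossible, i.e. the support avoids the coincidence locus
(`IsOffDiagonal.of_tsupport_subset`). -/
theorem offDiag_boxTensors_subset {E : Type*} [NormedAddCommGroup E] [NormedSpace ℝ E] {n m : ℕ}
    (Λ : E ≃L[ℝ] EuclideanSpace ℝ (Fin m)) (B : BoxData n m)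
    (hdisj : ∀ i j : Fin n, i ≠ j →
      Disjoint {x : E | ∀ c, (Λ x) c ∈ Ioo (B.l (i, c)) (B.u (i, c))}
        {x : E | ∀ c, (Λ x) c ∈ Ioo (B.l (j, c)) (B.u (j, c))}) :
    B.boxTensors Λ ⊆ {G : 𝓢((Fin n → E), ℂ) | G ∈ tensorProducts n ∧ IsOffDiagonal G} := by
  rintro P ⟨g, hg, hP⟩
  refine ⟨⟨g, hP⟩, IsOffDiagonal.of_tsupport_subset fun x hx hxc => ?_⟩
  obtain ⟨i, j, hij, hxij⟩ := hxc
  have hi : x i ∈ {x : E | ∀ c, (Λ x) c ∈ Ioo (B.l (i, c)) (B.u (i, c))} :=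
    hg i (tsupport_comp_subset (g := fun t : ℝ => (t : ℂ)) Complex.ofReal_zero _
      (hP.tsupport_subset hx i))
  have hj : x j ∈ {x : E | ∀ c, (Λ x) c ∈ Ioo (B.l (j, c)) (B.u (j, c))} :=
    hg j (tsupport_comp_subset (g := fun t : ℝ => (t : ℂ)) Complex.ofReal_zero _
      (hP.tsupport_subset hx j))
  rw [hxij] at hi
  exact Set.disjoint_left.1 (hdisj i j hij) hi hj

/-- **One piece of the lattice partition of a separated test function lies in the closed span.**  For `u`
supported at pairwise particle distances `≥ δ` (`tsupport u ⊆ Separated n δ`), `0 < h`, `12 h < δ` and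
`β ∈ ℤ^{4n}`, the piece `η_β · u` (`η_β` the lattice bump of `SchwartzPartition` in the mesh coordinates at
scale `h`) belongs to the closure of the span of the off-diagonal real tensor products: it is supported in
the closed box `∏ [(β_{ic} - 1) h, (β_{ic} + 1) h]`; unless it vanishes this box contains a point `v` with
`dist (v i) (v j) ≥ δ` (`i ≠ j`), so the outer blocks `∏_c ((β_{ic} - 2) h, (β_{ic} + 2) h)` are pairwise
disjoint (two points of blocks `i`, `j` with a common value force `dist (v i) (v j) ≤ √4 · 6 h = 12 h < δ`);
conclude by the box engine `mem_closure_span_boxTensors` and `offDiag_boxTensors_subset`. -/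
theorem offDiag_piece_mem_closure {n : ℕ} {u : 𝓢((Fin n → E4), ℂ)} {δ h : ℝ}
    (hu : tsupport (u : (Fin n → E4) → ℂ) ⊆ Separated n δ) (hh : 0 < h)
    (hhδ : 12 * h < δ) (β : Fin (n * 4) → ℤ) :
    SchwartzMap.smulLeftCLM ℂ (fun y => ((latticeBump (meshCoord n 4 h hh) β y : ℝ) : ℂ)) u ∈
      closure ((Submodule.span ℂ
        {G : 𝓢((Fin n → E4), ℂ) | G ∈ tensorProducts n ∧ IsOffDiagonal G} :
          Submodule ℂ 𝓢((Fin n → E4), ℂ)) :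
        Set 𝓢((Fin n → E4), ℂ)) := by
  -- adapted from `IsTimeOrdered.smulLeftCLM_latticeBump_translate_mem_closure` (`SchwartzOrderedWedgeDensity`)
  set G := SchwartzMap.smulLeftCLM ℂ (fun y => ((latticeBump (meshCoord n 4 h hh) β y : ℝ) : ℂ)) u
    with hG
  -- the box of `β` in the coordinates `v_i^c`
  obtain ⟨b, hb⟩ : ∃ b : Fin n × Fin 4 → ℝ, ∀ ic, b ic = ((β (finProdFinEquiv ic) : ℤ) : ℝ) :=
    ⟨_, fun _ => rfl⟩
  have hbox : ∀ v ∈ tsupport (G : (Fin n → E4) → ℂ), ∀ ic : Fin n × Fin 4,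
      b ic * h - h ≤ v ic.1 ic.2 ∧ v ic.1 ic.2 ≤ b ic * h + h := by
    intro v hv ic
    have h1 := (SchwartzMap.tsupport_smulLeftCLM_subset (F := ℂ) _ u hv).2
    rw [tsupport_latticeBumpC (meshCoord n 4 h hh) β] at h1
    have h2 := tsupport_latticeBump_subset (meshCoord n 4 h hh) β h1 (finProdFinEquiv ic)
    rw [meshCoord_apply, mem_Icc, ← hb ic] at h2
    constructor
    · have h3 : b ic - 1 ≤ v ic.1 ic.2 / h := by linarith [h2.1]
      rw [le_div_iff₀ hh] at h3
      linarith
    · have h3 : v ic.1 ic.2 / h ≤ b ic + 1 := by linarith [h2.2]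
      rw [div_le_iff₀ hh] at h3
      linarith
  -- the zero piece
  by_cases hG0 : G = 0
  · rw [hG0]
    exact subset_closure (Submodule.zero_mem _)
  -- otherwise a point of the support of `u` lies in the box
  obtain ⟨v, hv⟩ : ∃ v, G v ≠ 0 := by
    by_contra hcon
    push Not at hcon
    exact hG0 (SchwartzMap.ext hcon)
  have hvbox := hbox v (subset_tsupport _ hv)
  have huv : u v ≠ 0 := by
    rw [hG, SchwartzMap.smulLeftCLM_apply_apply
      (hasTemperateGrowth_latticeBumpC (meshCoord n 4 h hh) β)] at hv
    exact right_ne_zero_of_smul hv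
  have hsep : ∀ i j : Fin n, i ≠ j → δ ≤ dist (v i) (v j) := hu (subset_tsupport _ huv)
  -- the nested boxes
  let B : BoxData n 4 :=
    { l := fun ic => b ic * h - 2 * h, u := fun ic => b ic * h + 2 * h
      l' := fun ic => b ic * h - h, u' := fun ic => b ic * h + h
      hl := fun ic => by linarith, hl' := fun ic => by linarith, hu := fun ic => by linarith }
  let Λ₀ : E4 ≃L[ℝ] E4 := ContinuousLinearEquiv.refl ℝ _
  have hF' : tsupport (G : (Fin n → E4) → ℂ) ⊆
      {v | ∀ ic : Fin n × Fin 4, (Λ₀ (v ic.1)) ic.2 ∈ Icc (B.l' ic) (B.u' ic)} :=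
    fun v hv ic => hbox v hv ic
  -- the outer blocks are pairwise disjoint
  have hdisj : ∀ i j : Fin n, i ≠ j →
      Disjoint {x : E4 | ∀ c, (Λ₀ x) c ∈ Ioo (B.l (i, c)) (B.u (i, c))}
        {x : E4 | ∀ c, (Λ₀ x) c ∈ Ioo (B.l (j, c)) (B.u (j, c))} := by
    intro i j hij
    refine Set.disjoint_left.2 fun y hyi hyj => ?_
    have hc : ∀ c, |(v i - v j) c| ≤ 6 * h := fun c => by
      have h1 : b (i, c) * h - 2 * h < y c ∧ y c < b (i, c) * h + 2 * h := hyi c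
      have h2 : b (j, c) * h - 2 * h < y c ∧ y c < b (j, c) * h + 2 * h := hyj c
      have h3 := hvbox (i, c)
      have h4 := hvbox (j, c)
      dsimp only at h3 h4
      rw [PiLp.sub_apply, abs_le]
      constructor <;> linarith [h1.1, h1.2, h2.1, h2.2, h3.1, h3.2, h4.1, h4.2]
    have hdist : dist (v i) (v j) ≤ 12 * h := by
      have h0 := EuclideanSpace.norm_le_sqrt_card_mul (v i - v j) (by positivity : (0 : ℝ) ≤ 6 * h) hc
      rw [Fintype.card_fin, show ((4 : ℕ) : ℝ) = 2 ^ 2 by norm_num, Real.sqrt_sq (by norm_num)] at h0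
      rw [dist_eq_norm]
      linarith
    have h5 := hsep i j hij
    linarith
  exact closure_mono (Submodule.span_mono (offDiag_boxTensors_subset Λ₀ B hdisj))
    (mem_closure_span_boxTensors Λ₀ B G hF')

/-- **A separated test function lies in the closed span of the off-diagonal real tensor products.**  If
`tsupport u ⊆ Separated n δ` with `δ > 0`, then `u` is in the closure of the span: the lattice partition of
unity at mesh `δ / 24` converges on Schwartz space, `∑_{β ∈ [-R, R]^{4n}} η_β u = W_R u → u`
(`tendsto_latticeWindow_smul`), and every piece `η_β u` lies in the closed span
(`offDiag_piece_mem_closure`), which is a closed submodule. -/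
theorem offDiag_mem_closure_of_separated {n : ℕ} {u : 𝓢((Fin n → E4), ℂ)} {δ : ℝ}
    (hδ : 0 < δ) (hu : tsupport (u : (Fin n → E4) → ℂ) ⊆ Separated n δ) :
    u ∈ closure ((Submodule.span ℂ
        {G : 𝓢((Fin n → E4), ℂ) | G ∈ tensorProducts n ∧ IsOffDiagonal G} :
          Submodule ℂ 𝓢((Fin n → E4), ℂ)) :
        Set 𝓢((Fin n → E4), ℂ)) := by
  -- adapted from `IsTimeOrdered.mem_closure_span_slabOrderedProducts` (`SchwartzOrderedWedgeDensity`)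
  have hC : IsClosed (closure ((Submodule.span ℂ
      {G : 𝓢((Fin n → E4), ℂ) | G ∈ tensorProducts n ∧ IsOffDiagonal G} :
        Submodule ℂ 𝓢((Fin n → E4), ℂ)) :
      Set 𝓢((Fin n → E4), ℂ))) := isClosed_closure
  have hh : (0 : ℝ) < δ / 24 := by positivity
  set Λ := meshCoord n 4 (δ / 24) hh
  -- the lattice partition of unity at mesh `δ / 24`: `∑_β η_β · u = W_R · u → u`
  have hlim : Tendsto (fun R : ℕ => ∑ β ∈ latticeCube (n * 4) R,
      SchwartzMap.smulLeftCLM ℂ (fun y => ((latticeBump Λ β y : ℝ) : ℂ)) u) atTop (𝓝 u) := by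
    have hsum : ∀ R : ℕ, ∑ β ∈ latticeCube (n * 4) R,
        SchwartzMap.smulLeftCLM ℂ (fun y => ((latticeBump Λ β y : ℝ) : ℂ)) u =
          SchwartzMap.smulLeftCLM ℂ (fun y => ((latticeWindow Λ R y : ℝ) : ℂ)) u := by
      intro R
      have hW : (fun y => ((latticeWindow Λ R y : ℝ) : ℂ)) =
          fun y => ∑ β ∈ latticeCube (n * 4) R, ((latticeBump Λ β y : ℝ) : ℂ) := by
        funext y
        rw [← sum_latticeCube_latticeBump Λ R y, Complex.ofReal_sum]
      rw [hW, SchwartzMap.smulLeftCLM_sum fun β _ => hasTemperateGrowth_latticeBumpC Λ β,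
        FunLike.coe_sum, Finset.sum_apply]
    simp_rw [hsum]
    exact tendsto_latticeWindow_smul Λ ℂ u
  refine hC.mem_of_tendsto hlim (Eventually.of_forall fun R => ?_)
  -- every piece lies in the closed span
  exact (Submodule.span ℂ {G : 𝓢((Fin n → E4), ℂ) | G ∈ tensorProducts n ∧
      IsOffDiagonal G}).topologicalClosure.sum_mem fun β _ =>
    offDiag_piece_mem_closure hu hh (by linarith) β

/-- **Off-diagonal real tensor products are total in `⁰𝒮((ℝ⁴)ⁿ)`** (stub `stub_offDiagonalTensorDensity` of
line `Sketch`, reshape r3d).  Every `F ∈ ⁰𝒮((ℝ⁴)ⁿ)` (`IsOffDiagonal F`: `F` vanishes with all derivatives at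
coincident points) lies in the closure, in `𝓢(((ℝ⁴)ⁿ), ℂ)`, of the `ℂ`-span of the tensor products
`f₁ ⊗ ⋯ ⊗ fₙ` of complexified real one-point test functions (`tensorProducts n`) that are themselves in `⁰𝒮`.
Proof: `F` is the Schwartz limit of compactly supported cutoffs supported at pairwise distances `≥ δ_m > 0`
(`exists_separated_tendsto_of_isOffDiagonal`), each of which lies in the closed span
(`offDiag_mem_closure_of_separated`: lattice partition of unity at mesh `δ_m / 24` and the box Fourier-series
engine `mem_closure_span_boxTensors` over pairwise disjoint blocks).  The `⁰𝒮` form of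
`𝒮(ℝ^{4n}) = ⊗̂ⁿ 𝒮(ℝ⁴)` (OS 1973 §2). -/
theorem stub_offDiagonalTensorDensity : ∀ (n : ℕ) (F : 𝓢((Fin n → E4), ℂ)), IsOffDiagonal F →
    F ∈ closure ((Submodule.span ℂ {G : 𝓢((Fin n → E4), ℂ) | G ∈ tensorProducts n ∧ IsOffDiagonal G} :
      Submodule ℂ 𝓢((Fin n → E4), ℂ)) : Set 𝓢((Fin n → E4), ℂ)) := by
  intro n F hF
  obtain ⟨u, -, hsep, hlim⟩ := exists_separated_tendsto_of_isOffDiagonal F hF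
  refine isClosed_closure.mem_of_tendsto hlim (Eventually.of_forall fun m => ?_)
  obtain ⟨δ, hδ, hδsupp⟩ := hsep m
  exact offDiag_mem_closure_of_separated hδ hδsupp

end Summit.QuantumFields.QCD.Cruxes.StableActionBridge.Sketch

end
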